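import Summits.FinalStateConjecture.FinalStateConjecture.Theorems.ClusterCompletenessRecurrentlyFlatDispersesFutureSetCone

/-!
# Crux `RecurrentlyFlatDisperses` (stmt-FinalStateConjecture-14665), line `Sketch`
# (card `outgoing-blind-cup-restart`) — stub `stub_slabCauchy`, support file: the causal cone of an
# anchored chart and the past exit of a causal curve from the chart above a slab

Support file for the registered stub `stub_slabCauchy` (SLAB CAUCHY: every past-endless future
causal curve through a point of the chart above a late slab `Ψ₀{x⁰ = τ}` meets the slab), proved in
`…Theorems.ClusterCompletenessRecurrentlyFlatDispersesStubSlabCauchy` by a last-exit argument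
towards the past. This file contains:

* CAUSAL CONE ESTIMATE (`cone_of_deviation_causal`): the algebra of the neighbour's
  `FutureSet.cone_of_deviation` for CAUSAL instead of timelike vectors — if `‖Ψ^* g − η‖ ≤ 1/4`
  at `y` and `dΨ ∂₀` is future-directed, every `w ∈ E4` with `dΨ w` future-directed causal has
  `w⁰ > 0` and `‖w‖ < 2 w⁰` (`g(dΨ w, dΨ w) = ‖w‖² − 2(w⁰)² + dev(w, w) ≤ 0` and
  `g(dΨ ∂₀, dΨ w) = −w⁰ + dev(∂₀, w) < 0`, O'Neill 1983, Ch. 5, Lemma 5.29,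
  `TimeOrientation.IsFutureDirected.val_lt_zero`; `|dev(u, v)| ≤ ‖u‖‖v‖/4`);
* LIFT OF A CAUSAL CURVE (`lift_cone_causal`): the coordinate lift `Φ⁻¹ ∘ γ` of a future causal
  curve inside the image of an injective smooth local diffeomorphism `Φ : V → 𝓢`, `V ⊆ E4` open
  (`mdifferentiableAt_invFun_comp_and_mfderiv`, O'Neill 1983, Ch. 3, pp. 90–91), obeys the cone
  estimate: chart time strictly increasing, `‖c(s₂) − c(s₁)‖ ≤ 2 (c⁰(s₂) − c⁰(s₁))`;
* PAST EXIT (`exists_apply_eq_of_exit`, registered sub-goal): if a future causal curve `γ` on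
  `(σ, b]`, continuous at `σ`, runs inside the chart above the slab, `Φ{x⁰ > τ}` (`τ > τ₀`,
  `V = {x⁰ > τ₀}`), then `γ σ = Φ x` with `x⁰ ≥ τ`: towards the past the chart time of the lift
  decreases and stays `> τ`, the lift is Cauchy as `s ↓ σ` and converges in `V` (its limit has time
  `≥ τ > τ₀`), and its image converges both to `Φ` of the limit and to `γ σ` (Hausdorff) — the
  mirror image of the neighbour's `FutureSet.mem_range_of_bddAbove`.

Mathlib + the Literature cone only; no definitions, no named facts.
-/

noncomputable section

open scoped Manifold ContDiff Topology
open Bundle Filter Set Function TopologicalSpace Literature.Geometry.Lorentzian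

namespace Summit.FinalStateConjecture.FinalStateConjecture.Theorems.RecurrentlyFlatDisperses

namespace SlabCauchy

open FutureSet

/-! ### The causal cone of an anchored chart (the algebra of `FutureSet.cone_of_deviation`,
for causal instead of timelike vectors) -/

/-- `η(w, w) = ‖w‖² - 2 (w⁰)²` for the Minkowski form on `E4` (copied from the support file
`…FutureSetCone` of the neighbour `stub_futureSet`, where it is private). -/
private theorem minkowski_self_eq (w : E4) :
    Minkowski.bilin w w = ‖w‖ ^ 2 - 2 * w 0 ^ 2 := by
  have h1 : ‖w‖ ^ 2 = w 0 ^ 2 + ∑ i : Fin 3, w i.succ ^ 2 := by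
    rw [EuclideanSpace.real_norm_sq_eq]
    exact Fin.sum_univ_succ (fun i : Fin 4 ↦ w i ^ 2)
  have h2 : ∑ i : Fin 3, w i.succ * w i.succ = ∑ i : Fin 3, w i.succ ^ 2 :=
    Finset.sum_congr rfl fun i _ ↦ (sq _).symm
  rw [Minkowski.bilin_apply, h2, h1]
  ring

/-- Real-arithmetic core of the CAUSAL cone estimate: with `N = ‖w‖`, `t = w⁰`, `|a| ≤ N²/4`,
`|b| ≤ N/4`, the inequalities `N² - 2t² + a ≤ 0` (`G(w,w) ≤ 0`) and `-t + b < 0`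
(`G(∂₀, w) < 0`) force `t > 0` and `N < 2t`. -/
private theorem cone_arith_causal {N t a b : ℝ} (hN : 0 ≤ N) (ha : |a| ≤ 1 / 4 * N ^ 2)
    (hb : |b| ≤ 1 / 4 * N) (h1 : N ^ 2 - 2 * t ^ 2 + a ≤ 0) (h2 : -t + b < 0) :
    0 < t ∧ N < 2 * t := by
  have h3 : 3 / 4 * N ^ 2 ≤ 2 * t ^ 2 := by linarith [(abs_le.1 ha).1]
  have h5 : -(1 / 4 * N) < t := by linarith [(abs_le.1 hb).1]
  have ht : 0 < t := by
    by_contra ht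
    push Not at ht
    have h6 : t ^ 2 < (1 / 4 * N) ^ 2 := sq_lt_sq' h5 (by linarith)
    nlinarith [sq_nonneg N]
  refine ⟨ht, ?_⟩
  by_contra h
  push Not at h
  nlinarith [mul_le_mul h h (by linarith) hN, mul_pos ht ht]

/-- The pulled-back metric in terms of the deviation: `g(dΨ u, dΨ v) = η(u, v) + (Ψ^*g - η)(u, v)`,
and the operator-norm bounds `|(Ψ^*g - η)(w, w)| ≤ ‖w‖²/4`, `|(Ψ^*g - η)(∂₀, w)| ≤ ‖w‖/4` under the
anchor (copied from the support file `…FutureSetCone` of the neighbour `stub_futureSet`, where it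
is private). -/
private theorem val_mfderiv_eq_add_deviation {𝓢 : Spacetime 4} {U₀ : Opens E4}
    (Ψ : U₀ → 𝓢.carrier) (y : U₀)
    (h : ‖𝓢.deviation (Minkowski.backgroundOn U₀) Ψ y‖ ≤ 1 / 4) (w : E4) :
    𝓢.metric.val (Ψ y) (mfderiv 𝓘(ℝ, E4) (𝓡 4) Ψ y w) (mfderiv 𝓘(ℝ, E4) (𝓡 4) Ψ y w) =
        ‖w‖ ^ 2 - 2 * w 0 ^ 2 + 𝓢.deviation (Minkowski.backgroundOn U₀) Ψ y w w ∧
      𝓢.metric.val (Ψ y) (mfderiv 𝓘(ℝ, E4) (𝓡 4) Ψ y (E4.basisVector 0))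
          (mfderiv 𝓘(ℝ, E4) (𝓡 4) Ψ y w) =
        -w 0 + 𝓢.deviation (Minkowski.backgroundOn U₀) Ψ y (E4.basisVector 0) w ∧
      |𝓢.deviation (Minkowski.backgroundOn U₀) Ψ y w w| ≤ 1 / 4 * ‖w‖ ^ 2 ∧
      |𝓢.deviation (Minkowski.backgroundOn U₀) Ψ y (E4.basisVector 0) w| ≤ 1 / 4 * ‖w‖ := by
  have hn : ‖(E4.basisVector 0 : E4)‖ = 1 := by simp [E4.basisVector]
  have k1 : 𝓢.deviation (Minkowski.backgroundOn U₀) Ψ y w w =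
      𝓢.metric.val (Ψ y) (mfderiv 𝓘(ℝ, E4) (𝓡 4) Ψ y w) (mfderiv 𝓘(ℝ, E4) (𝓡 4) Ψ y w) -
        Minkowski.bilin w w :=
    𝓢.deviation_apply (Minkowski.backgroundOn U₀) Ψ y w w
  have k2 : 𝓢.deviation (Minkowski.backgroundOn U₀) Ψ y (E4.basisVector 0) w =
      𝓢.metric.val (Ψ y) (mfderiv 𝓘(ℝ, E4) (𝓡 4) Ψ y (E4.basisVector 0))
          (mfderiv 𝓘(ℝ, E4) (𝓡 4) Ψ y w) - Minkowski.bilin (E4.basisVector 0) w :=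
    𝓢.deviation_apply (Minkowski.backgroundOn U₀) Ψ y (E4.basisVector 0) w
  rw [minkowski_self_eq] at k1
  rw [Minkowski.bilin_basisVector_zero_left] at k2
  refine ⟨by linarith, by linarith, ?_, ?_⟩
  · rw [← Real.norm_eq_abs]
    refine (ContinuousLinearMap.le_opNorm₂ _ _ _).trans ?_
    have : ‖𝓢.deviation (Minkowski.backgroundOn U₀) Ψ y‖ * ‖w‖ * ‖w‖ ≤ 1 / 4 * ‖w‖ * ‖w‖ :=
      mul_le_mul_of_nonneg_right (mul_le_mul_of_nonneg_right h (norm_nonneg _)) (norm_nonneg _)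
    nlinarith [this]
  · rw [← Real.norm_eq_abs]
    refine (ContinuousLinearMap.le_opNorm₂ _ _ _).trans ?_
    rw [hn, mul_one]
    exact mul_le_mul_of_nonneg_right h (norm_nonneg _)

/-- **Causal cone estimate of the anchored chart.** If `‖Ψ^*g - η‖ ≤ 1/4` at `y` and `dΨ ∂₀` is
future-directed there, then every `w ∈ E4` whose push-forward `dΨ w` is future-directed (causal)
has positive time component and `‖w‖ < 2 w⁰`: `g(dΨ w, dΨ w) ≤ 0` gives `(3/4)‖w‖² ≤ 2(w⁰)²`, and
`g(dΨ ∂₀, dΨ w) < 0` (two future-directed vectors, one timelike: O'Neill 1983, Ch. 5, Lemma 5.29)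
gives `w⁰ > -‖w‖/4`. -/
theorem cone_of_deviation_causal {𝓢 : Spacetime 4} {U₀ : Opens E4} (Ψ : U₀ → 𝓢.carrier)
    (y : U₀) (h : ‖𝓢.deviation (Minkowski.backgroundOn U₀) Ψ y‖ ≤ 1 / 4)
    (hfut : 𝓢.timeOrientation.IsFutureDirected
      (mfderiv 𝓘(ℝ, E4) (𝓡 4) Ψ y (E4.basisVector 0)))
    (w : E4) (hwf : 𝓢.timeOrientation.IsFutureDirected (mfderiv 𝓘(ℝ, E4) (𝓡 4) Ψ y w)) :
    0 < w 0 ∧ ‖w‖ < 2 * w 0 := by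
  obtain ⟨e1, e2, b1, b2⟩ := val_mfderiv_eq_add_deviation Ψ y h w
  have hv0t : 𝓢.metric.IsTimelike (mfderiv 𝓘(ℝ, E4) (𝓡 4) Ψ y (E4.basisVector 0)) :=
    lt_of_le_of_lt (val_mfderiv_basisVector_zero_le Ψ y h) (by norm_num)
  have hlt := hfut.val_lt_zero 𝓢.timeOrientation hv0t hwf
  rw [e2] at hlt
  have hle : 𝓢.metric.val (Ψ y) (mfderiv 𝓘(ℝ, E4) (𝓡 4) Ψ y w)
      (mfderiv 𝓘(ℝ, E4) (𝓡 4) Ψ y w) ≤ 0 := hwf.1.1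
  rw [e1] at hle
  exact cone_arith_causal (norm_nonneg w) b1 b2 hle hlt

/-! ### The coordinate lift of a causal curve -/

/-- **The lifted curve in coordinates** (copied from the support file `…FutureSetCone` of the
neighbour `stub_futureSet`, where it is private). For `Φ : V → 𝓢` (`V ⊆ E4` open) an injective
`C^∞` local diffeomorphism and `γ` differentiable at `t` with `γ t ∈ Φ(V)`, the coordinate lift
`c = Φ⁻¹ ∘ γ : ℝ → E4` has a derivative `w` at `t` with `Φ(Φ⁻¹ γ t) = γ t` and `dΦ(w) = γ'(t)`
(O'Neill 1983, Ch. 3, pp. 90–91; `mdifferentiableAt_invFun_comp_and_mfderiv`). -/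
private theorem lift_hasDerivAt {𝓢 : Spacetime 4} {V : Opens E4} [Nonempty V]
    {Φ : V → 𝓢.carrier} (hΦs : ContMDiff 𝓘(ℝ, E4) (𝓡 4) ∞ Φ) (hinj : Injective Φ)
    (hloc : IsLocalDiffeomorph 𝓘(ℝ, E4) (𝓡 4) ∞ Φ) {γ : ℝ → 𝓢.carrier} {t : ℝ}
    (hγd : MDifferentiableAt 𝓘(ℝ, ℝ) (𝓡 4) γ t) (ht : γ t ∈ range Φ) :
    HasDerivAt (Subtype.val ∘ Function.invFun Φ ∘ γ)
        (velocity 𝓘(ℝ, E4) (Function.invFun Φ ∘ γ) t : E4) t ∧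
      Φ ((Function.invFun Φ ∘ γ) t) = γ t ∧
      mfderiv 𝓘(ℝ, E4) (𝓡 4) Φ ((Function.invFun Φ ∘ γ) t)
        (velocity 𝓘(ℝ, E4) (Function.invFun Φ ∘ γ) t) = velocity (𝓡 4) γ t := by
  obtain ⟨hzd, hΦz, hv⟩ := mdifferentiableAt_invFun_comp_and_mfderiv hΦs hinj hloc hγd ht
  refine ⟨?_, hΦz, hv⟩
  set z : ℝ → V := Function.invFun Φ ∘ γ with hz
  have h1 : HasMFDerivAt 𝓘(ℝ, ℝ) 𝓘(ℝ, E4) (Subtype.val ∘ z) t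
      ((ContinuousLinearMap.id ℝ E4).comp (mfderiv 𝓘(ℝ, ℝ) 𝓘(ℝ, E4) z t)) :=
    (hasMFDerivAt_subtypeVal (z t)).comp t hzd.hasMFDerivAt
  have h2 : mfderiv 𝓘(ℝ, ℝ) 𝓘(ℝ, E4) (Subtype.val ∘ z) t = mfderiv 𝓘(ℝ, ℝ) 𝓘(ℝ, E4) z t := by
    rw [h1.mfderiv, ContinuousLinearMap.id_comp]
  have h3 : DifferentiableAt ℝ (Subtype.val ∘ z) t :=
    mdifferentiableAt_iff_differentiableAt.mp h1.mdifferentiableAt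
  have h4 : HasDerivAt (Subtype.val ∘ z) (deriv (Subtype.val ∘ z) t) t := h3.hasDerivAt
  have h5 : deriv (Subtype.val ∘ z) t = (velocity 𝓘(ℝ, E4) z t : E4) := by
    show fderiv ℝ (Subtype.val ∘ z) t 1 = mfderiv 𝓘(ℝ, ℝ) 𝓘(ℝ, E4) z t 1
    rw [← mfderiv_eq_fderiv, h2]
    rfl
  rw [h5] at h4
  exact h4

/-- Transport of future-directedness along an equality of base points (the tangent spaces are
all `E4` definitionally). -/
private theorem isFutureDirected_transport {𝓢 : Spacetime 4} {p q : 𝓢.carrier} (h : p = q)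
    {u : TangentSpace (𝓡 4) p} {u' : TangentSpace (𝓡 4) q} (huu : (u : E4) = u')
    (hf : 𝓢.timeOrientation.IsFutureDirected u') : 𝓢.timeOrientation.IsFutureDirected u := by
  subst h
  have : u = u' := huu
  subst this
  exact hf

/-- **Cone estimate along the lift of a causal curve**: for `Φ : V → 𝓢` (`V ⊆ E4` open) an
injective `C^∞` local diffeomorphism whose differential satisfies the causal cone estimate, at a
parameter where `γ` is differentiable with future-directed (causal) velocity inside `Φ(V)` the
coordinate lift `c = Φ⁻¹ ∘ γ` has a derivative `w = c'(t)` with `w⁰ > 0` and `‖w‖ < 2 w⁰`. -/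
theorem lift_cone_causal {𝓢 : Spacetime 4} {V : Opens E4} [Nonempty V] {Φ : V → 𝓢.carrier}
    (hΦs : ContMDiff 𝓘(ℝ, E4) (𝓡 4) ∞ Φ) (hinj : Injective Φ)
    (hloc : IsLocalDiffeomorph 𝓘(ℝ, E4) (𝓡 4) ∞ Φ)
    (hcone : ∀ (x : V) (w : E4),
      𝓢.timeOrientation.IsFutureDirected (mfderiv 𝓘(ℝ, E4) (𝓡 4) Φ x w) →
      0 < w 0 ∧ ‖w‖ < 2 * w 0)
    {γ : ℝ → 𝓢.carrier} {t : ℝ} (hγd : MDifferentiableAt 𝓘(ℝ, ℝ) (𝓡 4) γ t)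
    (hγf : 𝓢.timeOrientation.IsFutureDirected (velocity (𝓡 4) γ t)) (ht : γ t ∈ range Φ) :
    HasDerivAt (Subtype.val ∘ Function.invFun Φ ∘ γ)
        (deriv (Subtype.val ∘ Function.invFun Φ ∘ γ) t) t ∧
      0 < deriv (Subtype.val ∘ Function.invFun Φ ∘ γ) t 0 ∧
      ‖deriv (Subtype.val ∘ Function.invFun Φ ∘ γ) t‖ <
        2 * deriv (Subtype.val ∘ Function.invFun Φ ∘ γ) t 0 := by
  obtain ⟨hd, hΦz, hv⟩ := lift_hasDerivAt hΦs hinj hloc hγd ht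
  have hfd := isFutureDirected_transport hΦz hv hγf
  refine ⟨hd.differentiableAt.hasDerivAt, ?_⟩
  rw [hd.deriv]
  exact hcone _ _ hfd

/-! ### The last exit towards the past: the limit of the lift -/

/-- **The past exit point of a causal curve from the chart above a slab is charted, at chart time
`≥ τ`** (registered sub-goal `exists_apply_eq_of_exit` of stub `stub_slabCauchy`). Setting: `Φ : V → 𝓢` an injective `C^∞` local diffeomorphism on the late half-space
`V = {x⁰ > τ₀}` satisfying the causal cone estimate, `τ₀ < τ`; `γ` a future causal curve on
`(σ, b]`, `σ < b`, continuous at `σ`, with `γ((σ, b])` inside the chart ABOVE the slab,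
`Φ{x⁰ > τ}`. Then `γ σ = Φ x` for some `x ∈ V` with `x⁰ ≥ τ`: the chart time of the coordinate
lift `c = Φ⁻¹ ∘ γ` increases (so it decreases towards the past, bounded below by `τ`) and
`‖c s₂ - c s₁‖ ≤ 2 (c⁰ s₂ - c⁰ s₁)`, so the lift is Cauchy as `s ↓ σ` and converges to a point
`x` of `E4` with `x⁰ = inf c⁰ ≥ τ > τ₀`, i.e. `x ∈ V`, whose image is the limit `γ σ`
(Hausdorff). -/
theorem exists_apply_eq_of_exit : ∀ {𝓢 : Spacetime 4} {V : Opens E4} [Nonempty V]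
    {Φ : V → 𝓢.carrier} {τ₀ τ : ℝ}, ContMDiff 𝓘(ℝ, E4) (𝓡 4) ∞ Φ → Function.Injective Φ →
    IsLocalDiffeomorph 𝓘(ℝ, E4) (𝓡 4) ∞ Φ →
    (∀ (x : V) (w : E4),
      𝓢.timeOrientation.IsFutureDirected (mfderiv 𝓘(ℝ, E4) (𝓡 4) Φ x w) →
      0 < w 0 ∧ ‖w‖ < 2 * w 0) →
    (∀ p : E4, p ∈ V ↔ τ₀ < p 0) → τ₀ < τ →
    ∀ {γ : ℝ → 𝓢.carrier} {σ b : ℝ}, σ < b →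
    𝓢.metric.IsFutureCausalCurveOn 𝓢.timeOrientation γ (Set.Ioc σ b) →
    (∀ u ∈ Set.Ioc σ b, ∃ x : V, Φ x = γ u ∧ τ < (x : E4) 0) → ContinuousAt γ σ →
    ∃ x : V, Φ x = γ σ ∧ τ ≤ (x : E4) 0 := by
  intro 𝓢 V _ Φ τ₀ τ hΦs hinj hloc hcone hVmem hτ γ σ b hσb hγ hW hcont
  set c : ℝ → E4 := fun u ↦ ((Function.invFun Φ (γ u) : V) : E4) with hc
  have hrange : ∀ u ∈ Ioc σ b, γ u ∈ range Φ := fun u hu ↦ by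
    obtain ⟨x, hx, -⟩ := hW u hu
    exact ⟨x, hx⟩
  -- chart time above `τ` along `(σ, b]`
  have hcτ : ∀ u ∈ Ioc σ b, τ < c u 0 := fun u hu ↦ by
    obtain ⟨x, hx, hxτ⟩ := hW u hu
    have : Function.invFun Φ (γ u) = x := by
      rw [← hx]
      exact Function.leftInverse_invFun hinj x
    show τ < ((Function.invFun Φ (γ u) : V) : E4) 0
    rw [this]
    exact hxτ
  -- derivative and cone estimate along the lift
  have hder : ∀ u ∈ Ioc σ b, HasDerivAt c (deriv c u) u ∧ 0 < deriv c u 0 ∧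
      ‖deriv c u‖ < 2 * deriv c u 0 := fun u hu ↦
    lift_cone_causal hΦs hinj hloc hcone (hγ u hu).1 (hγ u hu).2 (hrange u hu)
  have hmono : StrictMonoOn (fun u ↦ c u 0) (Ioc σ b) :=
    strictMonoOn_apply_zero (w := fun u ↦ deriv c u) (convex_Ioc σ b)
      fun u hu ↦ ⟨(hder u hu).1, (hder u hu).2.1⟩
  have hdisp : ∀ s₁ s₂ : ℝ, σ < s₁ → s₁ ≤ s₂ → s₂ ≤ b →
      ‖c s₂ - c s₁‖ ≤ 2 * (c s₂ 0 - c s₁ 0) := fun s₁ s₂ h1 h12 h2 ↦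
    norm_sub_le_of_hasDerivAt (w := fun u ↦ deriv c u) h12 fun u hu ↦
      ⟨(hder u ⟨lt_of_lt_of_le h1 hu.1, hu.2.trans h2⟩).1,
        (hder u ⟨lt_of_lt_of_le h1 hu.1, hu.2.trans h2⟩).2.2.le⟩
  -- the lift is Cauchy at `σ⁺`
  set L : ℝ := sInf ((fun u ↦ c u 0) '' Ioc σ b) with hL
  have hne : ((fun u ↦ c u 0) '' Ioc σ b).Nonempty := ⟨c b 0, b, ⟨hσb, le_rfl⟩, rfl⟩
  have hbdd : BddBelow ((fun u ↦ c u 0) '' Ioc σ b) := ⟨τ, by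
    rintro _ ⟨u, hu, rfl⟩
    exact (hcτ u hu).le⟩
  have hτL : τ ≤ L := le_csInf hne (by
    rintro _ ⟨u, hu, rfl⟩
    exact (hcτ u hu).le)
  have hfL : ∀ u ∈ Ioc σ b, L ≤ c u 0 := fun u hu ↦ csInf_le hbdd ⟨u, hu, rfl⟩
  have hcau : Cauchy (map c (𝓝[>] σ)) := by
    rw [Metric.cauchy_iff]
    refine ⟨inferInstance, fun ε hε ↦ ?_⟩
    obtain ⟨_, ⟨s₁, hs₁, rfl⟩, hLs₁⟩ := exists_lt_of_csInf_lt hne (show L < L + ε / 4 by linarith)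
    refine ⟨c '' Ioc σ s₁, image_mem_map (Ioc_mem_nhdsGT hs₁.1), ?_⟩
    rintro _ ⟨u, hu, rfl⟩ _ ⟨u', hu', rfl⟩
    have key : ∀ v v' : ℝ, v ∈ Ioc σ s₁ → v' ∈ Ioc σ s₁ → v ≤ v' → dist (c v) (c v') < ε := by
      intro v v' hv hv' hvv'
      rw [dist_comm, dist_eq_norm]
      have h1 := hdisp v v' hv.1 hvv' (hv'.2.trans hs₁.2)
      have h2 := hfL v ⟨hv.1, hv.2.trans hs₁.2⟩
      have h3 : c v' 0 ≤ c s₁ 0 :=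
        hmono.monotoneOn ⟨hv'.1, hv'.2.trans hs₁.2⟩ hs₁ hv'.2
      have h4 : c s₁ 0 < L + ε / 4 := hLs₁
      linarith
    rcases le_total u u' with h | h
    · exact key u u' hu hu' h
    · rw [dist_comm]; exact key u' u hu' hu h
  obtain ⟨p, hp⟩ := CompleteSpace.complete hcau
  have hp' : Tendsto c (𝓝[>] σ) (𝓝 p) := hp
  -- the limit point lies in `V`, at chart time `≥ τ`
  have hp0 : Tendsto (fun u ↦ c u 0) (𝓝[>] σ) (𝓝 (p 0)) :=
    ((PiLp.continuous_apply 2 (fun _ : Fin 4 ↦ ℝ) 0).tendsto p).comp hp'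
  have hev : ∀ᶠ u in 𝓝[>] σ, τ ≤ c u 0 := by
    filter_upwards [Ioc_mem_nhdsGT hσb] with u hu
    exact (hcτ u hu).le
  have hpτ : τ ≤ p 0 := ge_of_tendsto hp0 hev
  have hpV : p ∈ V := (hVmem p).2 (lt_of_lt_of_le hτ hpτ)
  -- the images converge to `Φ` of the limit, and to `γ σ`
  have hz : Tendsto (fun u ↦ (Function.invFun Φ (γ u) : V)) (𝓝[>] σ) (𝓝 ⟨p, hpV⟩) :=
    tendsto_subtype_rng.2 hp'
  have hΦz : Tendsto (fun u ↦ Φ (Function.invFun Φ (γ u))) (𝓝[>] σ) (𝓝 (Φ ⟨p, hpV⟩)) :=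
    (hΦs.continuous.tendsto _).comp hz
  have heq : (fun u ↦ Φ (Function.invFun Φ (γ u))) =ᶠ[𝓝[>] σ] γ := by
    filter_upwards [Ioc_mem_nhdsGT hσb] with u hu
    exact Function.invFun_eq (hrange u hu)
  have hlim : Tendsto γ (𝓝[>] σ) (𝓝 (Φ ⟨p, hpV⟩)) := hΦz.congr' heq
  have hlim' : Tendsto γ (𝓝[>] σ) (𝓝 (γ σ)) := hcont.tendsto.mono_left nhdsWithin_le_nhds
  exact ⟨⟨p, hpV⟩, tendsto_nhds_unique hlim hlim', hpτ⟩

end SlabCauchy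

end Summit.FinalStateConjecture.FinalStateConjecture.Theorems.RecurrentlyFlatDisperses

end
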